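import Mathlib.Combinatorics.SimpleGraph.Basic
import Mathlib.Algebra.Ring.Parity
import Literature.Computability.Complexity.CNF
import Literature.Computability.MetaComplexity.Resolution
import Literature.Computability.MetaComplexity.ResolutionProofs
import HarnessLib

/-!
# The grid Tseitin contradiction over a finite variable type

`tseitinCNF` (Resolution.lean) numbers the edge variables of a graph on `Fin v` by natural
numbers `< v²`.  For lifting arguments the variable (block) set must be a FINITE type, so this
file renames variables (`renameCNF`, with its evaluation / unsatisfiability / size lemmas) and
packages the standard hard base formula of Håstad–Risse: the Tseitin contradiction of the
`n × n` grid with all charges `1` (odd total charge for odd `n`), `gridTseitin n`, over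
`Fin (n·n·(n·n) + 1)`.

## References
* A. Urquhart, *Hard examples for resolution*, J. ACM 34 (1987), §4 [Urquhart1987].
* J. Håstad, K. Risse, *On bounded depth proofs for Tseitin formulas on the grid; revisited*,
  FOCS 2022 / SICOMP 2025, §2 [HastadRisse2025].
-/

namespace Literature.Computability.MetaComplexity

open Literature.Computability.Complexity

universe u

variable {ν μ : Type u}

/-! ### Renaming variables -/

/-- Rename the variables of a CNF along `f`. [folklore] -/
def renameCNF (f : ν → μ) (φ : CNF ν) : CNF μ :=
  φ.map (List.map fun l => (f l.1, l.2))

/-- Renaming a clause composes the assignment with `f`. [folklore] -/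
theorem clause_eval_map_rename (f : ν → μ) (c : Clause ν) (σ : μ → Bool) :
    Clause.eval σ (c.map fun l => (f l.1, l.2)) = Clause.eval (σ ∘ f) c := by
  induction c with
  | nil => rfl
  | cons l c ih =>
      simp only [List.map_cons, Clause.eval, List.any_cons] at *
      rw [ih]
      rfl

/-- Renaming composes the assignment with `f`: `(φ ∘ f)(σ) = φ(σ ∘ f)`. [folklore] -/
theorem eval_renameCNF (f : ν → μ) (φ : CNF ν) (σ : μ → Bool) :
    (renameCNF f φ).eval σ = φ.eval (σ ∘ f) := by
  induction φ with
  | nil => rfl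
  | cons c φ ih =>
      simp only [renameCNF, List.map_cons, CNF.eval_cons] at *
      rw [ih, clause_eval_map_rename]

/-- Renaming preserves unsatisfiability (no injectivity needed). [folklore] -/
theorem not_satisfiable_renameCNF (f : ν → μ) {φ : CNF ν} (h : ¬ φ.Satisfiable) :
    ¬ (renameCNF f φ).Satisfiable := by
  rintro ⟨σ, hσ⟩
  exact h ⟨σ ∘ f, by rw [← eval_renameCNF]; exact hσ⟩

/-- Renaming preserves size. [folklore] -/
theorem size_renameCNF (f : ν → μ) (φ : CNF ν) : (renameCNF f φ).size = φ.size := by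
  induction φ with
  | nil => rfl
  | cons c φ ih =>
      simp only [renameCNF, List.map_cons, CNF.size, List.sum_cons, List.length_map] at *
      rw [ih]

/-! ### The grid -/

/-- Adjacency of the `n × n` grid on `Fin (n·n)` (vertex `a` sits at row `a / n`, column
`a % n`): horizontal or vertical neighbours. [cite: HastadRisse2025, §2] -/
def gridAdj (n : ℕ) (a b : Fin (n * n)) : Prop :=
  ((a : ℕ) / n = (b : ℕ) / n ∧ ((a : ℕ) % n + 1 = (b : ℕ) % n ∨ (b : ℕ) % n + 1 = (a : ℕ) % n)) ∨
    ((a : ℕ) % n = (b : ℕ) % n ∧ ((a : ℕ) / n + 1 = (b : ℕ) / n ∨ (b : ℕ) / n + 1 = (a : ℕ) / n))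

/-- Grid adjacency is decidable. [cite: HastadRisse2025, §2] -/
instance gridAdj.decidable (n : ℕ) (a b : Fin (n * n)) : Decidable (gridAdj n a b) := by
  unfold gridAdj; infer_instance

/-- The `n × n` grid graph `G_n` on `Fin (n·n)`. [cite: HastadRisse2025, §2] -/
def gridGraph (n : ℕ) : SimpleGraph (Fin (n * n)) where
  Adj := gridAdj n
  symm := ⟨fun a b h => by
    rcases h with ⟨h1, h2⟩ | ⟨h1, h2⟩
    · exact Or.inl ⟨h1.symm, h2.symm⟩
    · exact Or.inr ⟨h1.symm, h2.symm⟩⟩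
  loopless := ⟨fun a h => by
    rcases h with ⟨_, h | h⟩ | ⟨_, h | h⟩ <;> omega⟩

/-- The grid graph has decidable adjacency (needed by `tseitinCNF`). [cite: HastadRisse2025, §2] -/
instance gridGraph.decidableRel (n : ℕ) : DecidableRel (gridGraph n).Adj :=
  fun a b => gridAdj.decidable n a b

/-! ### The base formula -/

/-- The number of (renamed) variables of `gridTseitin n`, minus one: `n·n·(n·n)` bounds every
`tseitinEdgeVar` of a graph on `Fin (n·n)`. [cite: Urquhart1987, §4] -/
def gridVarBound (n : ℕ) : ℕ := n * n * (n * n)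

/-- Folding natural-number variable names into `Fin (N+1)` (the identity below `N+1`).
[folklore] -/
def foldVar (N : ℕ) (i : ℕ) : Fin (N + 1) := ⟨i % (N + 1), Nat.mod_lt _ (Nat.succ_pos N)⟩

/-- The GRID TSEITIN contradiction `Ts(G_n)`: the Tseitin CNF of the `n × n` grid with all
charges `1`, variables renamed into the finite type `Fin (gridVarBound n + 1)`.
[cite: HastadRisse2025, §2] -/
def gridTseitin (n : ℕ) : CNF (Fin (gridVarBound n + 1)) :=
  renameCNF (foldVar (gridVarBound n)) (tseitinCNF (gridGraph n) fun _ => true)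

/-- For odd `n` the grid Tseitin formula is unsatisfiable (odd total charge `n²`;
`tseitinCNF_not_satisfiable_holds`). [cite: Urquhart1987, Lemma 4.1] -/
theorem gridTseitin_not_satisfiable (n : ℕ) (hn : Odd n) : ¬ (gridTseitin n).Satisfiable := by
  refine not_satisfiable_renameCNF _ ?_
  refine tseitinCNF_not_satisfiable_holds (gridGraph n) (fun _ => true) ?_
  simpa using hn.mul hn

end Literature.Computability.MetaComplexity
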